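import Literature.MathematicalPhysics.QuantumFieldTheory.Balaban1983to89.Beta.SquareTable

/-!
# `Balaban1983to89.Beta.SquareTableAvgFirst` — AVERAGE-FIRST MIXED LEGS (RULING (R14-6)): the base-point-averaged scalar wall of
`SquareTable` §15 with the PER-BASE-POINT mixed second differences replaced by CROSS-BASE-POINT ones, by summation by parts over the
block average (β sub-cell, row BETA-an3 gen 7, BETA-SPEC v1.9z §7.25 (R14-6) «average-first is admissible and needs no new socket»;
table-side companion of an1's `VectorTails`, the supplier shape).  Mathematically this is `SquareTable` §16; it is a separate module
ONLY because the gate caps a tree file at 200 kB (`SquareTable` v1.7 is 143 kB, this section 61 kB) — nothing of `SquareTable` is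
restated, everything is imported and opened.

HONEST FRAMING (mandatory, page 1).  «discharging `BetaPertH` makes Bałaban's UV stability UNCONDITIONAL — a real
constructive-QFT result; it is NOT the continuum limit and NOT the Clay problem.»  Gloss 1 (the LEAD's, BETA-SPEC §0):
«unconditional» means the coupling-window HYPOTHESIS of [Balaban1989LargeFieldII] (B16) p. 355's one displayed END STATEMENT is
discharged INSIDE THE LATTICE RENORMALIZATION PROGRAMME; every other input remains a verbatim QUOTATION of Bałaban's printed
theorems — the result is «B16's theorem with one hypothesis fewer», not a first-principles formalisation of B5–B16.  Gloss 2: the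
object is the `EventualForm`-unconditional END statement, NOT «Theorem 2 as printed».  Gloss 3″ (v1.9r §7.20 (c), binding): the
interval hypothesis of [Balaban1987RG1] Thm 2 p. 259 is REPLACED by the (R10-1′) carrier of PARTIAL SUMS; what is made
unconditional is an END STATEMENT under the explicit γ-smallness restrictions of the kernel binders — never «Theorem 2 as printed»,
never the continuum limit / mass gap / Clay.  NOTHING in this module is summit progress: it is [folklore] algebra and bookkeeping over
the tree's definitions and asserts nothing about Bałaban's propagators.

WHAT THIS MODULE IS.  The kernels behind the wall's actual legs are one-shot entries of TWO arguments, `𝒢(x,x′)`, read per base point as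
`G_{n,b}(w) = 𝒢(b+w,b)`.  The mixed second difference of a SINGLE `G_{n,b}` is then `∇^{(1)}_μ∇^{(1)}_ν𝒢` — two differences on the FIRST
argument — for which no printed-with-proof entry-wise bound is available (RULING (R14-6), on an1's located normalisation gap: the printed
propagator bounds typed in the tree as `B5.Prop12Printed` ((1.110)–(1.113)) and `B5.Kernel126_127Printed` ((1.126)–(1.127)) are SUP-SOURCE
bounds giving, through an1's parametrix dictionary, the VALUE and ONE difference PER ARGUMENT of an entry, hence `∇^{(2)}∇^{(1)}`-type
profiles; a per-entry `∇^{(1)}∇^{(1)}` or a `sup‖∇∇G‖` bound is not printed — context only, nothing of it is used here); `SquareTable` §15's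
binders `h2/d2` asked for exactly that per-`b` quantity.  This module removes it, by ALGEBRA ([folklore]):
* DERIVED (§2, any base-point type `κB`, any family `G : κB → ℤ⁴ → ℝ`, any permutation `sh` of `κB`).  With `Y_b = F_νG_b` and the
  CROSS-BASE-POINT second difference `X_b(w) = F_νG_b(w+e_μ) − F_νG_{sh b}(w)` (`crossMix`; for `sh b = b+e_μ` it is `−∇^{(2)}_μ∇^{(1)}_ν𝒢` at
  `(b+e_μ+w, b)`: ONE difference on each argument) one has `D_{μν}G_b = X_b + (Y_{sh b} − Y_b)` identically; for `sh` preserving a finite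
  set `B` of base points and weights `wt` on it (the caller's reading: the residue-class translation by `e_μ` of the block under the
  uniform average) SUMMATION BY PARTS IN `b`, `Σ_b wt_b·Y_{sh b}·S_b = Σ_b wt_b·Y_b·S_{sh⁻¹b}` (`sum_perm_shift`), moves the offending
  difference OFF the single base point: the `wt`-averaged stencil integrand `Σ_b wt_b·stK(G_b)(w)` EQUALS, POINTWISE IN `w`
  (`avg_stK_eq_avg_stKx`; per `b` the defect is an explicit boundary term, `stK_eq_stKx_add`, averaging to zero, `sum_bdry_eq_zero`), the
  `wt`-average of the integrand `stKx_b` of an ENLARGED leg table over `AfIdx = BfIdx ⊕ Fin 3` (§1) — the realised table with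
  `D_{μν}G_b ↦ X_b` in its three mixed products (`stPx/stQx`), plus three COMPANION products `F_νG_b · (G_{sh⁻¹b} − G_b)(· + α_j)` at the
  displacements `α_j = e_μ+e_ν, e_ν, 0` (`crossAt`, `compShift`) carrying the mixed products' coefficients (`afCoeff`), with table legs
  `free.fwdLeg ν × zeroLeg 3` (`afP/afQ`, degree `3 + 3`, `hdeg_af`; the companions have NO free part because `gFree` does not depend on
  `b`: `stPx_sub_free`, `stQx_sub_free`).
* DERIVED (§1).  The enlarged table has the SAME continuum bubble, `hval` (`kappaBal N`, Bałaban's normalised constant exactly) and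
  transfer constant as the realised one (`contBubble_af`, `hval_af`, `bubbleConst_af`: zero legs contribute nothing), so the lead's socket
  `ComposedRoad.oneLoopDrift_of_composedLegInterfacePow_identity_avg` applies VERBATIM with the enlarged index set.
* DERIVED (§3).  Its four leg binders follow from EIGHT SCALAR graded bounds per base point with `b`-free constants (`hFx_of_graded`,
  `hGx_of_graded`, `hFxtail_of_decay`, `hGxtail_of_decay`, through the pointwise lemmas `abs_stPx_le_local`, `abs_stQx_le_local`,
  `abs_stPx_le_of_decay`, `abs_stQx_le_of_decay` and `WindowInterface.windowBound_of_scaleBound`): `h0/h1/d0/d1` as in `SquareTable` §15;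
  the cross-base-point FIRST difference at fixed displacement `|G_{n,sh b}(v) − G_{n,b}(v)|` (`h1×`: `D₃/n³` on the whole lattice; `d1×`:
  `A₃e^{−(δ/n)‖v‖}‖v‖⁻³` off the origin — for `sh b = b+e_μ` the DIAGONAL difference `𝒢(x+e_μ,x′+e_μ) − 𝒢(x,x′)`, one first- plus one
  second-argument difference); the cross-base-point SECOND difference `X_b` (`h2×`: `D₂/n⁴` against `gFree`; `d2×`:
  `A₂e^{−(δ/n)‖v‖}‖v‖⁻⁴`).  NO per-`b` mixed second difference and NO `sup‖∇∇G‖` bound appear anywhere.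
* DERIVED (§4).  The full-sum comparison is `SquareTable` §15's (W3b′)ₛₜ-avg UNCHANGED (`Σ_b wt_b·fullSum (stK G_{Lc^m,b})`, the honest
  per-base-point closed form of `SquareTable` §§11–12): under the new hypotheses the per-`b` full sums CONVERGE (`exists_tendsto_psum_stK`:
  `D_{μν}G_b = X_b + Y_{sh b} − Y_b` has degree-`3` exponential decay, one power short of the table's and irrelevant for summability —
  `decay_cube_le_halfRate` trades half the rate for the missing power), their `wt`-combination is the full sum of the averaged kernel
  (`sum_mul_fullSum_eq`), which is the full sum of the averaged RE-LABELLED kernel (the pointwise identity), whose window truncation is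
  uniform in `b` (the re-labelled leg tails are `b`-free; `hident_avgFirst`, via `SquareTable.hident_of_fullSum_graded` and
  `ComposedRoad.abs_convexComb_le`).
* DERIVED (§5).  **`oneLoopDrift_of_scalarBounds_avgFirst`** — `SquareTable.oneLoopDrift_of_scalarBounds_avg` with `h2/d2` REPLACED by
  `h1×/h2×/d1×/d2×` and the shift structure `(sh, hshB, hwtsh)`; SAME conclusion SHAPE (`bubbleConst` of the realised table, `kappaBal N`;
  the window and tail sums of the constant run over `AfIdx` with the vectors `Rx/Sx/Rx′/Sx′`); **`endpointExistence_of_scalarBounds_avgFirst`**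
  — the end statement `EndpointExistence Cn` with the verbatim downstream binders of `SquareTable` §14.
* NOT TOUCHED (located, by name).  Nothing about Bałaban's propagators is asserted: the eight graded bounds, the shift structure and
  (W3b′)ₛₜ-avg are HYPOTHESES.  Supplier shape: an1 `Beta.VectorTails` (two-argument parametrix with value + one gradient PER ARGUMENT and
  `∇^{(2)}∇^{(1)}` entry profiles); the reading of a block-structured one-shot kernel per base point, and of the block average's
  translation as `sh`, is the caller's; the (N1)/(I2-b) identification behind (W3b′)ₛₜ-avg is an2's / the lead's (BETA-SPEC §7.25 (c)).

Sources.  None used.  [Balaban1987RG1] (INDEX B12) p. 264 (1.20)–(1.22): CONTEXT (the moment whose shape `hval` serves); the B5 decls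
named above: CONTEXT (why the per-base-point mixed difference is replaced).  [Lawler1991]/[LawlerLimic2010] enter ONLY through the imported
unconditional legs of `TwoPowerLegs`/`BubbleTransfer` (kernel theorems there).  Tags: [folklore] = elementary algebra proved here, or a
definition asserting nothing.  No `axiom`, no `sorry`.  v1 (2026-08-19, unit `b2b-balaban-beta-an3-g7`); staged byte-identically in the cell
package `run/shared/lean/pub/pub-balaban/lean/BalabanYm4/Literature/MathematicalPhysics/QuantumFieldTheory/Balaban1983to89/Beta/SquareTableAvgFirst.lean`.
-/

noncomputable section

namespace Literature.MathematicalPhysics.QuantumFieldTheory.Balaban1983to89.Beta.SquareTableAvgFirst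

open Finset
open scoped BigOperators
open Literature.Probability.LatticeModels (latticeGreen annulus)
open Literature.MathematicalPhysics.QuantumFieldTheory.Balaban1983to89
open Literature.MathematicalPhysics.QuantumFieldTheory.Balaban1983to89.Beta
open Literature.MathematicalPhysics.QuantumFieldTheory.Balaban1983to89.Beta.BubbleTransfer
open Literature.MathematicalPhysics.QuantumFieldTheory.Balaban1983to89.Beta.TwoPowerLegs
open Literature.MathematicalPhysics.QuantumFieldTheory.Balaban1983to89.Beta.TransverseStructure
open Literature.MathematicalPhysics.QuantumFieldTheory.Balaban1983to89.Beta.TransverseLink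
open Literature.MathematicalPhysics.QuantumFieldTheory.Balaban1983to89.Beta.LeadingCoefficient
open Literature.MathematicalPhysics.QuantumFieldTheory.Balaban1983to89.Beta.GhostTable
open Literature.MathematicalPhysics.QuantumFieldTheory.Balaban1983to89.Beta.BlockLegs (supNorm_add_le_real)
open Literature.MathematicalPhysics.QuantumFieldTheory.Balaban1983to89.Beta.DyadicShell (Pt toReal supNorm norm_toReal toReal_add
  supNorm_eq_zero_iff toReal_eq_zero_iff)
open Literature.MathematicalPhysics.QuantumFieldTheory.Balaban1983to89.Beta.SquareTable

/-! ## §1 The enlarged (average-first) table: zero legs, companions, same continuum bubble and `hval` -/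

section AvgFirstTable

variable {μ ν : Fin 4}

/-- **THE ZERO LEG of nominal degree `a`**: `f = 0`, `ℓ = 0`, `A = B = 0` — the table slot of an ACTUAL leg with no free part (the
cross-base-point differences of this module, which vanish identically for a base-point-independent family). [folklore] -/
def zeroLeg (a : ℕ) : Leg where
  f := fun _ _ _ => 0
  ℓ := fun _ => 0
  a := a
  A := 0
  B := 0
  nonneg_A := le_rfl
  nonneg_B := le_rfl
  lead := fun w _ => by simp
  err := fun L k w _ => by simp

/-- unfolding. [folklore] -/
@[simp] theorem zeroLeg_f (a L k : ℕ) (w : Pt) : (zeroLeg a).f L k w = 0 := rfl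
/-- unfolding. [folklore] -/
@[simp] theorem zeroLeg_ℓ (a : ℕ) (x : E4) : (zeroLeg a).ℓ x = 0 := rfl
/-- unfolding. [folklore] -/
@[simp] theorem zeroLeg_a (a : ℕ) : (zeroLeg a).a = a := rfl
/-- unfolding. [folklore] -/
@[simp] theorem zeroLeg_A (a : ℕ) : (zeroLeg a).A = 0 := rfl
/-- unfolding. [folklore] -/
@[simp] theorem zeroLeg_B (a : ℕ) : (zeroLeg a).B = 0 := rfl

/-- Index set of the ENLARGED (average-first) table: the realised table's six products (`BfIdx`) plus three COMPANION products (`Fin 3`).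
[folklore] -/
abbrev AfIdx : Type := BfIdx ⊕ Fin 3

/-- the realised-table indices of the three MIXED products (`D_{μν}G` as first leg against `G(·+e_μ+e_ν)` and `G(·+e_ν)`, as second leg
against `G`), whose coefficients the companions inherit. [folklore] -/
def compIdx : Fin 3 → BfIdx := ![Sum.inl 0, Sum.inl 1, Sum.inr true]

variable (μ ν) in
/-- the displacements at which the three companion second legs are read: far corner `e_μ+e_ν`, corner `e_ν`, base `0`. [folklore] -/
def compShift : Fin 3 → Pt := ![unitVec μ + unitVec ν, unitVec ν, 0]

/-- coefficients of the enlarged table: the realised ones, and the mixed products' coefficients on the companions. [folklore] -/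
def afCoeff (N : ℝ) : AfIdx → ℝ := Sum.elim (bfCoeff N) (fun j => bfCoeff N (compIdx j))

/-- first legs of the enlarged table: the realised ones, and `F_ν gFree` (degree `3`) on the companions. [folklore] -/
def afP (hμν : μ ≠ ν) : AfIdx → Leg := Sum.elim (bfP hμν) (fun _ => free.fwdLeg ν)

/-- second legs of the enlarged table: the realised ones, and the ZERO leg of degree `3` on the companions. [folklore] -/
def afQ (hμν : μ ≠ ν) : AfIdx → Leg := Sum.elim (bfQ hμν) (fun _ => zeroLeg 3)

/-- degree bookkeeping of the enlarged table: `6` throughout (companions `3 + 3`). [folklore] -/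
theorem hdeg_af (hμν : μ ≠ ν) : ∀ i ∈ (Finset.univ : Finset AfIdx), (afP hμν i).a + (afQ hμν i).a = 6 := by
  rintro (i | j) _
  · exact hdeg_bf hμν i (Finset.mem_univ _)
  · simp [afP, afQ, TwoPower.fwdLeg_a]

/-- the first legs of the enlarged table have degree `≥ 2`. [folklore] -/
theorem two_le_afP_a (hμν : μ ≠ ν) (i : AfIdx) : 2 ≤ (afP hμν i).a := by
  rcases i with i | j
  · exact two_le_bfP_a hμν i
  · simp [afP, TwoPower.fwdLeg_a]

/-- the second legs of the enlarged table have degree `≥ 2`. [folklore] -/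
theorem two_le_afQ_a (hμν : μ ≠ ν) (i : AfIdx) : 2 ≤ (afQ hμν i).a := by
  rcases i with i | j
  · exact two_le_bfQ_a hμν i
  · simp [afQ]

/-- **THE COMPANIONS CONTRIBUTE NOTHING TO THE CONTINUUM BUBBLE** (their second table leg is zero). [folklore] -/
theorem contBubble_af (hμν : μ ≠ ν) (N : ℝ) (x : E4) :
    contBubble Finset.univ (afCoeff N) (afP hμν) (afQ hμν) x = contBubble Finset.univ (bfCoeff N) (bfP hμν) (bfQ hμν) x := by
  simp [contBubble, Fintype.sum_sum_type, afCoeff, afP, afQ]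

/-- **`hval` OF THE ENLARGED TABLE = `hval` OF THE REALISED TABLE** (`kappaBal N` exactly). [folklore] -/
theorem hval_af (hμν : μ ≠ ν) (N : ℝ) :
    ∀ x : E4, x ≠ 0 → x μ * x ν * contBubble Finset.univ (afCoeff N) (afP hμν) (afQ hμν) x = leadingIntegrand (kappaBal N) μ ν x :=
  fun x hx => by rw [contBubble_af]; exact hval_bf hμν N x hx

/-- **THE TRANSFER CONSTANT OF THE ENLARGED TABLE = THAT OF THE REALISED TABLE** (the companions' second table leg has `A = B = 0`).
[folklore] -/
theorem bubbleConst_af (hμν : μ ≠ ν) (N : ℝ) :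
    bubbleConst Finset.univ (afCoeff N) (afP hμν) (afQ hμν) = bubbleConst Finset.univ (bfCoeff N) (bfP hμν) (bfQ hμν) := by
  simp [bubbleConst, Fintype.sum_sum_type, afCoeff, afP, afQ]

end AvgFirstTable

/-! ## §2 The re-labelling identity: cross-base-point differences and summation by parts over the block average -/

section Relabel

variable {μ ν : Fin 4} {κB : Type*}

variable (μ ν) in
/-- **THE CROSS-BASE-POINT MIXED SECOND DIFFERENCE** `X_b(w) = [G_b(w+e_μ+e_ν) − G_b(w+e_μ)] − [G_{sh b}(w+e_ν) − G_{sh b}(w)]` of a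
base-point-indexed family (`sh` a permutation of the base points).  For `G_b(w) = 𝒢(b+w,b)` and `sh b = b+e_μ` this is
`−∇^{(2)}_μ∇^{(1)}_ν𝒢` at `(b+e_μ+w, b)`: ONE difference on each argument. [folklore] -/
def crossMix (sh : Equiv.Perm κB) (G : κB → Pt → ℝ) (b : κB) (w : Pt) : ℝ :=
  (G b (w + unitVec μ + unitVec ν) - G b (w + unitVec μ)) - (G (sh b) (w + unitVec ν) - G (sh b) w)

/-- **THE COMPANION SECOND LEGS**: the cross-base-point FIRST difference `G_{sh⁻¹ b}(w+α) − G_b(w+α)` at displacement `α` (for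
`sh b = b+e_μ`: the DIAGONAL difference `𝒢(x−e_μ,x′−e_μ) − 𝒢(x,x′)` at `(b+w+α, b)` — one first- plus one second-argument difference).
[folklore] -/
def crossAt (sh : Equiv.Perm κB) (G : κB → Pt → ℝ) (b : κB) (α : Pt) (w : Pt) : ℝ :=
  G (sh.symm b) (w + α) - G b (w + α)

variable (μ ν) in
/-- **THE RE-LABELLED FIRST LEGS** over `AfIdx` at base point `b`: the realised stencils of `G_b` with `D_{μν}G_b ↦ X_b` in the two products
where it is the first leg, and `F_νG_b` on the three companions. [folklore] -/
def stPx (sh : Equiv.Perm κB) (G : κB → Pt → ℝ) (b : κB) : AfIdx → Pt → ℝ :=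
  Sum.elim
    (Sum.elim ![crossMix μ ν sh G b, crossMix μ ν sh G b, stP μ ν (G b) (Sum.inl 2), stP μ ν (G b) (Sum.inl 3)]
      (fun t => stP μ ν (G b) (Sum.inr t)))
    (fun _ w => G b (w + unitVec ν) - G b w)

variable (μ ν) in
/-- **THE RE-LABELLED SECOND LEGS**: the realised stencils of `G_b` with `D_{μν}G_b ↦ X_b` in the product where it is the second leg, and
the cross-base-point first differences `crossAt` at the displacements `compShift` on the companions. [folklore] -/
def stQx (sh : Equiv.Perm κB) (G : κB → Pt → ℝ) (b : κB) : AfIdx → Pt → ℝ :=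
  Sum.elim
    (Sum.elim (fun i => stQ μ ν (G b) (Sum.inl i))
      (fun t => if t then crossMix μ ν sh G b else stQ μ ν (G b) (Sum.inr false)))
    (fun j => crossAt sh G b (compShift μ ν j))

variable (μ ν) in
/-- the weighted RE-LABELLED kernel `w_μw_ν·Σ_{i} afCoeff_i·stPx_i·stQx_i (w)` at base point `b`. [folklore] -/
def stKx (N : ℝ) (sh : Equiv.Perm κB) (G : κB → Pt → ℝ) (b : κB) (w : Pt) : ℝ :=
  toReal w μ * toReal w ν * ∑ i ∈ (Finset.univ : Finset AfIdx), afCoeff N i * (stPx μ ν sh G b i w * stQx μ ν sh G b i w)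

variable (μ ν) in
/-- the BOUNDARY TERM of the re-labelling at base point `b`, companion `j`: `c_j·(Y_{sh b}·S^j_b − Y_b·S^j_{sh⁻¹ b})(w)` with
`Y_b = F_νG_b`, `S^j_b = G_b(· + α_j)` — it telescopes to zero under a `sh`-invariant average over `b`. [folklore] -/
def bdry (N : ℝ) (sh : Equiv.Perm κB) (G : κB → Pt → ℝ) (b : κB) (w : Pt) (j : Fin 3) : ℝ :=
  bfCoeff N (compIdx j) *
    ((G (sh b) (w + unitVec ν) - G (sh b) w) * G b (w + compShift μ ν j) -
      (G b (w + unitVec ν) - G b w) * G (sh.symm b) (w + compShift μ ν j))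

/-- **THE RE-LABELLING IDENTITY PER BASE POINT** (pure algebra: `D_{μν}G_b = X_b + Y_{sh b} − Y_b`):
`stK(G_b)(w) = stKx_b(w) + w_μw_ν·Σ_j bdry_b(w,j)`. [folklore] -/
theorem stK_eq_stKx_add (N : ℝ) (sh : Equiv.Perm κB) (G : κB → Pt → ℝ) (b : κB) (w : Pt) :
    stK μ ν N (G b) w = stKx μ ν N sh G b w + toReal w μ * toReal w ν * ∑ j : Fin 3, bdry μ ν N sh G b w j := by
  simp only [stK, stKx, bdry, Fintype.sum_sum_type, Fin.sum_univ_four, Fin.sum_univ_three, Fintype.sum_bool, afCoeff, bfCoeff,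
    compIdx, compShift, stPx, stQx, stP, stQ, crossMix, crossAt, sqCoeff, ghostCoeff, Sum.elim_inl, Sum.elim_inr,
    Matrix.cons_val_zero, Matrix.cons_val_one, Matrix.cons_val, if_true, Bool.false_eq_true, if_false, add_zero, add_assoc,
    add_comm (unitVec ν) (unitVec μ)]
  ring

/-- **SUMMATION BY PARTS OVER THE BASE POINTS**: for a permutation `sh` preserving the finite set `B` and the weights on it,
`Σ_{b∈B} wt_b·Y(sh b)·S(b) = Σ_{b∈B} wt_b·Y(b)·S(sh⁻¹ b)`. [folklore] -/
theorem sum_perm_shift {B : Finset κB} {wt : κB → ℝ} (sh : Equiv.Perm κB) (hB : ∀ b, sh b ∈ B ↔ b ∈ B)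
    (hwt : ∀ b ∈ B, wt (sh b) = wt b) (Y S : κB → ℝ) :
    ∑ b ∈ B, wt b * (Y (sh b) * S b) = ∑ b ∈ B, wt b * (Y b * S (sh.symm b)) := by
  refine Finset.sum_equiv sh (fun b => (hB b).symm) ?_
  intro b hb
  rw [hwt b hb, Equiv.symm_apply_apply]

/-- the boundary terms average to zero. [folklore] -/
theorem sum_bdry_eq_zero (N : ℝ) {B : Finset κB} {wt : κB → ℝ} (sh : Equiv.Perm κB) (hB : ∀ b, sh b ∈ B ↔ b ∈ B)
    (hwt : ∀ b ∈ B, wt (sh b) = wt b) (G : κB → Pt → ℝ) (w : Pt) (j : Fin 3) :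
    ∑ b ∈ B, wt b * bdry μ ν N sh G b w j = 0 := by
  have e : ∀ b, wt b * bdry μ ν N sh G b w j =
      bfCoeff N (compIdx j) * (wt b * ((G (sh b) (w + unitVec ν) - G (sh b) w) * G b (w + compShift μ ν j))) -
        bfCoeff N (compIdx j) * (wt b * ((G b (w + unitVec ν) - G b w) * G (sh.symm b) (w + compShift μ ν j))) := by
    intro b; simp only [bdry]; ring
  simp_rw [e]
  rw [Finset.sum_sub_distrib, ← Finset.mul_sum, ← Finset.mul_sum,
    sum_perm_shift sh hB hwt (fun b => G b (w + unitVec ν) - G b w) (fun b => G b (w + compShift μ ν j)), sub_self]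

/-- **THE AVERAGED STENCIL KERNEL IS THE AVERAGED RE-LABELLED KERNEL, POINTWISE IN `w`** (`sh` preserving `B` and `wt`). [folklore] -/
theorem avg_stK_eq_avg_stKx (N : ℝ) {B : Finset κB} {wt : κB → ℝ} (sh : Equiv.Perm κB) (hB : ∀ b, sh b ∈ B ↔ b ∈ B)
    (hwt : ∀ b ∈ B, wt (sh b) = wt b) (G : κB → Pt → ℝ) (w : Pt) :
    ∑ b ∈ B, wt b * stK μ ν N (G b) w = ∑ b ∈ B, wt b * stKx μ ν N sh G b w := by
  have h0 : ∑ b ∈ B, (wt b * ∑ j : Fin 3, bdry μ ν N sh G b w j) = 0 := by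
    simp_rw [Finset.mul_sum]
    rw [Finset.sum_comm]
    exact Finset.sum_eq_zero fun j _ => sum_bdry_eq_zero (μ := μ) (ν := ν) N sh hB hwt G w j
  calc ∑ b ∈ B, wt b * stK μ ν N (G b) w
      = ∑ b ∈ B, (wt b * stKx μ ν N sh G b w + toReal w μ * toReal w ν * (wt b * ∑ j : Fin 3, bdry μ ν N sh G b w j)) :=
        Finset.sum_congr rfl fun b _ => by rw [stK_eq_stKx_add (μ := μ) (ν := ν) N sh G b w]; ring
    _ = ∑ b ∈ B, wt b * stKx μ ν N sh G b w + toReal w μ * toReal w ν * ∑ b ∈ B, (wt b * ∑ j : Fin 3, bdry μ ν N sh G b w j) := by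
        rw [Finset.sum_add_distrib, ← Finset.mul_sum]
    _ = ∑ b ∈ B, wt b * stKx μ ν N sh G b w := by rw [h0, mul_zero, add_zero]

/-- **THE FREE PARTS OF THE RE-LABELLED FIRST LEGS ARE THE ENLARGED TABLE'S** (because `gFree` does not depend on the base point):
`stPx(G)_i − (afP i).f = stPx(G − gFree)_i`. [folklore] -/
theorem stPx_sub_free (hμν : μ ≠ ν) (sh : Equiv.Perm κB) (G : κB → Pt → ℝ) (b : κB) (i : AfIdx) (L k : ℕ) (w : Pt) :
    stPx μ ν sh G b i w - (afP hμν i).f L k w = stPx μ ν sh (fun b v => G b v - gFree v) b i w := by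
  rcases i with (i | t) | j
  · fin_cases i
    · simp [stPx, afP, bfP, sqP, freeMixedLeg_f, crossMix, add_right_comm w (unitVec ν) (unitVec μ)]
      ring
    · simp [stPx, afP, bfP, sqP, freeMixedLeg_f, crossMix, add_right_comm w (unitVec ν) (unitVec μ)]
      ring
    · simp [stPx, afP, bfP, sqP, stP, TwoPower.fwdLeg_f, gFree]
      ring
    · simp [stPx, afP, bfP, sqP, stP, TwoPower.fwdLeg_f, gFree]
      ring
  · cases t
    · simp [stPx, afP, bfP, ghostP, stP, TwoPower.fwdLeg_f, gFree]
      ring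
    · simp [stPx, afP, bfP, ghostP, stP, TwoPower.baseLeg_f, gFree]
  · simp only [stPx, afP, Sum.elim_inr, TwoPower.fwdLeg_f, free_g_eq]
    ring

/-- (second legs; the companions' table leg is zero and `gFree(w+α)` cancels across base points). [folklore] -/
theorem stQx_sub_free (hμν : μ ≠ ν) (sh : Equiv.Perm κB) (G : κB → Pt → ℝ) (b : κB) (i : AfIdx) (L k : ℕ) (w : Pt) :
    stQx μ ν sh G b i w - (afQ hμν i).f L k w = stQx μ ν sh (fun b v => G b v - gFree v) b i w := by
  rcases i with (i | t) | j
  · fin_cases i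
    · simp [stQx, afQ, bfQ, sqQ, stQ, shiftLeg₂_f]
    · simp [stQx, afQ, bfQ, sqQ, stQ, shiftLeg₁_f]
    · simp [stQx, afQ, bfQ, sqQ, stQ, fwdLegAt_f]
      ring
    · simp [stQx, afQ, bfQ, sqQ, stQ, TwoPower.fwdLeg_f, gFree]
      ring
  · cases t
    · simp [stQx, afQ, bfQ, ghostQ, stQ, TwoPower.fwdLeg_f, gFree]
      ring
    · simp [stQx, afQ, bfQ, ghostQ, freeMixedLeg_f, crossMix, add_right_comm w (unitVec ν) (unitVec μ)]
      ring
  · simp only [stQx, afQ, Sum.elim_inr, zeroLeg_f, crossAt]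
    ring

end Relabel

/-! ## §3 Window and tail binders of the re-labelled legs from eight scalar graded bounds per base point -/

section RelabelBounds

variable {μ ν : Fin 4} {κB : Type*}

/-- **LOCAL BOUNDS ⟹ RE-LABELLED FIRST-LEG BOUNDS** (one base point, one lattice point; used for the window binder with `E_b = G_b − gFree`
and for the tail binder with `G_b` itself): value `e₀`, unit forward differences `e₁`, cross-base-point second difference `e₂` AT `w` give
`|stPx_i| ≤ e_{a_i−2}` on the realised slots and `≤ e₁` on the companions. [folklore] -/
theorem abs_stPx_le_local (hμν : μ ≠ ν) (sh : Equiv.Perm κB) (G : κB → Pt → ℝ) (b : κB) (w : Pt) {e : ℕ → ℝ}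
    (h0 : |G b w| ≤ e 0) (h1 : ∀ ρ : Fin 4, |G b (w + unitVec ρ) - G b w| ≤ e 1) (h2x : |crossMix μ ν sh G b w| ≤ e 2) (i : AfIdx) :
    |stPx μ ν sh G b i w| ≤ Sum.elim (fun i => e ((bfP hμν i).a - 2)) (fun _ => e 1) i := by
  rcases i with (i | t) | j
  · fin_cases i
    · simpa [stPx, bfP, sqP] using h2x
    · simpa [stPx, bfP, sqP] using h2x
    · simpa [stPx, stP, bfP, sqP] using h1 μ
    · simpa [stPx, stP, bfP, sqP] using h1 μ
  · cases t
    · simpa [stPx, stP, bfP, ghostP] using h1 μ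
    · simpa [stPx, stP, bfP, ghostP] using h0
  · simpa [stPx] using h1 ν

/-- **LOCAL BOUNDS ⟹ RE-LABELLED SECOND-LEG BOUNDS** (hypotheses at the four corners of the cell of `w`; `ex` bounds the companions'
cross-base-point first differences at the three displacements). [folklore] -/
theorem abs_stQx_le_local (hμν : μ ≠ ν) (sh : Equiv.Perm κB) (G : κB → Pt → ℝ) (b : κB) (w : Pt) {e : ℕ → ℝ} {ex : ℝ}
    (h0a : |G b (w + (unitVec μ + unitVec ν))| ≤ e 0) (h0b : |G b (w + unitVec ν)| ≤ e 0)
    (h1a : |G b (w + (unitVec μ + unitVec ν)) - G b (w + unitVec μ)| ≤ e 1) (h1b : |G b (w + unitVec ν) - G b w| ≤ e 1)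
    (h2x : |crossMix μ ν sh G b w| ≤ e 2) (hx : ∀ j : Fin 3, |crossAt sh G b (compShift μ ν j) w| ≤ ex) (i : AfIdx) :
    |stQx μ ν sh G b i w| ≤ Sum.elim (fun i => e ((bfQ hμν i).a - 2)) (fun _ => ex) i := by
  rcases i with (i | t) | j
  · fin_cases i
    · simpa [stQx, stQ, bfQ, sqQ] using h0a
    · simpa [stQx, stQ, bfQ, sqQ] using h0b
    · simpa [stQx, stQ, bfQ, sqQ] using h1a
    · simpa [stQx, stQ, bfQ, sqQ] using h1b
  · cases t
    · simpa [stQx, stQ, bfQ, ghostQ] using h1b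
    · simpa [stQx, bfQ, ghostQ, freeMixedLeg_a] using h2x
  · simpa [stQx] using hx j

/-- window constants of the re-labelled first legs: `D_{a_i−2}` on the realised slots (so `D₂`, the constant of the CROSS second
difference, on the two `X_b` slots), `D₁` on the companions. [folklore] -/
def Rx (hμν : μ ≠ ν) (D : ℕ → ℝ) : AfIdx → ℝ := Sum.elim (fun i => D ((bfP hμν i).a - 2)) (fun _ => D 1)

/-- window constants of the re-labelled second legs: `D_{b_i−2}` on the realised slots, `D₃` (the constant of the cross-base-point FIRST
difference) on the companions. [folklore] -/
def Sx (hμν : μ ≠ ν) (D : ℕ → ℝ) : AfIdx → ℝ := Sum.elim (fun i => D ((bfQ hμν i).a - 2)) (fun _ => D 3)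

/-- tail constants of the re-labelled first legs: `A_{a_i−2}` realised, `A₁` companions. [folklore] -/
def Rx' (hμν : μ ≠ ν) (A : ℕ → ℝ) : AfIdx → ℝ := Sum.elim (fun i => A ((bfP hμν i).a - 2)) (fun _ => A 1)

/-- tail constants of the re-labelled second legs: `2^{b_i}A_{b_i−2}` realised, `2³A₃` companions. [folklore] -/
def Sx' (hμν : μ ≠ ν) (A : ℕ → ℝ) : AfIdx → ℝ := Sum.elim (fun i => A ((bfQ hμν i).a - 2) * 2 ^ (bfQ hμν i).a) (fun _ => A 3 * 2 ^ 3)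

/-- the window constants `Rx` are nonnegative for a nonnegative profile. [folklore] -/
theorem Rx_nonneg (hμν : μ ≠ ν) {D : ℕ → ℝ} (hD : ∀ j, 0 ≤ D j) (i : AfIdx) : 0 ≤ Rx hμν D i := by
  rcases i with i | j <;> simp [Rx, hD]

/-- the window constants `Sx` are nonnegative for a nonnegative profile. [folklore] -/
theorem Sx_nonneg (hμν : μ ≠ ν) {D : ℕ → ℝ} (hD : ∀ j, 0 ≤ D j) (i : AfIdx) : 0 ≤ Sx hμν D i := by
  rcases i with i | j <;> simp [Sx, hD]

/-- the tail constants `Rx′` are nonnegative for a nonnegative profile. [folklore] -/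
theorem Rx'_nonneg (hμν : μ ≠ ν) {A : ℕ → ℝ} (hA : ∀ j, 0 ≤ A j) (i : AfIdx) : 0 ≤ Rx' hμν A i := by
  rcases i with i | j <;> simp [Rx', hA]

/-- the tail constants `Sx′` are nonnegative for a nonnegative profile. [folklore] -/
theorem Sx'_nonneg (hμν : μ ≠ ν) {A : ℕ → ℝ} (hA : ∀ j, 0 ≤ A j) (i : AfIdx) : 0 ≤ Sx' hμν A i := by
  rcases i with i | j
  · simp only [Sx', Sum.elim_inl]; exact mul_nonneg (hA _) (by positivity)
  · simp only [Sx', Sum.elim_inr]; exact mul_nonneg (hA 3) (by positivity)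

/-- **THE WINDOW BINDER OF THE RE-LABELLED FIRST LEGS FROM GRADED BOUNDS** (per base point `b ∈ Bset n`, `n = Lc^m`): `h0/h1` as in §10 and
the CROSS second difference `h2×` (`D₂/n⁴`) — no per-`b` mixed second difference. [folklore] -/
theorem hFx_of_graded (hμν : μ ≠ ν) {Lc : ℕ} (hL : 2 ≤ Lc) {M : ℕ → ℕ} (hML : ∀ n : ℕ, 2 ≤ n → M n ≤ n)
    {Bset : ℕ → Finset κB} {sh : ℕ → Equiv.Perm κB} {Gf : ℕ → κB → Pt → ℝ} {D : ℕ → ℝ} (hD : ∀ j, 0 ≤ D j)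
    (h0 : ∀ n : ℕ, 2 ≤ n → ∀ b ∈ Bset n, ∀ v, |Gf n b v - gFree v| ≤ D 0 / (n : ℝ) ^ 2)
    (h1 : ∀ n : ℕ, 2 ≤ n → ∀ b ∈ Bset n, ∀ v (ρ : Fin 4),
      |(Gf n b (v + unitVec ρ) - gFree (v + unitVec ρ)) - (Gf n b v - gFree v)| ≤ D 1 / (n : ℝ) ^ 3)
    (h2x : ∀ n : ℕ, 2 ≤ n → ∀ b ∈ Bset n, ∀ v,
      |(Gf n b (v + unitVec μ + unitVec ν) - gFree (v + unitVec μ + unitVec ν)) - (Gf n b (v + unitVec μ) - gFree (v + unitVec μ)) -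
          ((Gf n (sh n b) (v + unitVec ν) - gFree (v + unitVec ν)) - (Gf n (sh n b) v - gFree v))| ≤ D 2 / (n : ℝ) ^ 4) :
    ∀ m : ℕ, 1 ≤ m → ∀ b ∈ Bset (Lc ^ m), ∀ w ∈ annulus 4 0 (M (Lc ^ m)), ∀ i ∈ (Finset.univ : Finset AfIdx),
      |stPx μ ν (sh (Lc ^ m)) (Gf (Lc ^ m)) b i w - (afP hμν i).f (Lc ^ m) 0 w| ≤
        Rx hμν D i / ((supNorm w : ℝ) ^ ((afP hμν i).a - 2) * ((Lc ^ m : ℕ) : ℝ) ^ 2) := by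
  intro m hm b hb w hw i _
  have hn : 2 ≤ Lc ^ m := hL.trans (Nat.le_self_pow (by omega) Lc)
  have hmw := DyadicShell.mem_annulus_iff.mp hw
  have hw0 : w ≠ 0 := DyadicShell.ne_zero_of_mem_annulus hw
  have hwn : (supNorm w : ℝ) ≤ ((Lc ^ m : ℕ) : ℝ) := by exact_mod_cast hmw.2.trans (hML _ hn)
  have key : |stPx μ ν (sh (Lc ^ m)) (Gf (Lc ^ m)) b i w - (afP hμν i).f (Lc ^ m) 0 w| ≤
      Rx hμν D i / ((Lc ^ m : ℕ) : ℝ) ^ (afP hμν i).a := by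
    rw [stPx_sub_free]
    have hb' := abs_stPx_le_local hμν (sh (Lc ^ m)) (fun b v => Gf (Lc ^ m) b v - gFree v) b w
      (e := fun j => D j / ((Lc ^ m : ℕ) : ℝ) ^ (j + 2)) (h0 _ hn b hb w) (fun ρ => h1 _ hn b hb w ρ)
      (by simpa [crossMix] using h2x _ hn b hb w) i
    rcases i with i | j
    · have ha : (bfP hμν i).a - 2 + 2 = (bfP hμν i).a := Nat.sub_add_cancel (two_le_bfP_a hμν i)
      simp only [Sum.elim_inl, ha] at hb'
      simpa [Rx, afP] using hb'
    · simpa [Rx, afP] using hb'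
  exact WindowInterface.windowBound_of_scaleBound (Rx_nonneg hμν hD i) (two_le_afP_a hμν i) hw0 hwn key

/-- **THE WINDOW BINDER OF THE RE-LABELLED SECOND LEGS FROM GRADED BOUNDS**: `h0/h1`, the cross second difference `h2×` and the
cross-base-point FIRST difference `h1×` (`|G_{n,sh b} − G_{n,b}| ≤ D₃/n³`, used at `sh⁻¹ b ∈ Bset n`). [folklore] -/
theorem hGx_of_graded (hμν : μ ≠ ν) {Lc : ℕ} (hL : 2 ≤ Lc) {M : ℕ → ℕ} (hML : ∀ n : ℕ, 2 ≤ n → M n ≤ n)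
    {Bset : ℕ → Finset κB} {sh : ℕ → Equiv.Perm κB} {Gf : ℕ → κB → Pt → ℝ} {D : ℕ → ℝ} (hD : ∀ j, 0 ≤ D j)
    (hshB : ∀ n : ℕ, 2 ≤ n → ∀ b, sh n b ∈ Bset n ↔ b ∈ Bset n)
    (h0 : ∀ n : ℕ, 2 ≤ n → ∀ b ∈ Bset n, ∀ v, |Gf n b v - gFree v| ≤ D 0 / (n : ℝ) ^ 2)
    (h1 : ∀ n : ℕ, 2 ≤ n → ∀ b ∈ Bset n, ∀ v (ρ : Fin 4),
      |(Gf n b (v + unitVec ρ) - gFree (v + unitVec ρ)) - (Gf n b v - gFree v)| ≤ D 1 / (n : ℝ) ^ 3)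
    (h1x : ∀ n : ℕ, 2 ≤ n → ∀ b ∈ Bset n, ∀ v, |Gf n (sh n b) v - Gf n b v| ≤ D 3 / (n : ℝ) ^ 3)
    (h2x : ∀ n : ℕ, 2 ≤ n → ∀ b ∈ Bset n, ∀ v,
      |(Gf n b (v + unitVec μ + unitVec ν) - gFree (v + unitVec μ + unitVec ν)) - (Gf n b (v + unitVec μ) - gFree (v + unitVec μ)) -
          ((Gf n (sh n b) (v + unitVec ν) - gFree (v + unitVec ν)) - (Gf n (sh n b) v - gFree v))| ≤ D 2 / (n : ℝ) ^ 4) :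
    ∀ m : ℕ, 1 ≤ m → ∀ b ∈ Bset (Lc ^ m), ∀ w ∈ annulus 4 0 (M (Lc ^ m)), ∀ i ∈ (Finset.univ : Finset AfIdx),
      |stQx μ ν (sh (Lc ^ m)) (Gf (Lc ^ m)) b i w - (afQ hμν i).f (Lc ^ m) 0 w| ≤
        Sx hμν D i / ((supNorm w : ℝ) ^ ((afQ hμν i).a - 2) * ((Lc ^ m : ℕ) : ℝ) ^ 2) := by
  intro m hm b hb w hw i _
  have hn : 2 ≤ Lc ^ m := hL.trans (Nat.le_self_pow (by omega) Lc)
  have hmw := DyadicShell.mem_annulus_iff.mp hw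
  have hw0 : w ≠ 0 := DyadicShell.ne_zero_of_mem_annulus hw
  have hwn : (supNorm w : ℝ) ≤ ((Lc ^ m : ℕ) : ℝ) := by exact_mod_cast hmw.2.trans (hML _ hn)
  have hb' : (sh (Lc ^ m)).symm b ∈ Bset (Lc ^ m) := by
    rw [← hshB _ hn, Equiv.apply_symm_apply]; exact hb
  have key : |stQx μ ν (sh (Lc ^ m)) (Gf (Lc ^ m)) b i w - (afQ hμν i).f (Lc ^ m) 0 w| ≤
      Sx hμν D i / ((Lc ^ m : ℕ) : ℝ) ^ (afQ hμν i).a := by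
    rw [stQx_sub_free]
    have hcx : ∀ j : Fin 3, |crossAt (sh (Lc ^ m)) (fun b v => Gf (Lc ^ m) b v - gFree v) b (compShift μ ν j) w| ≤
        D 3 / ((Lc ^ m : ℕ) : ℝ) ^ 3 := by
      intro j
      have e : crossAt (sh (Lc ^ m)) (fun b v => Gf (Lc ^ m) b v - gFree v) b (compShift μ ν j) w =
          -(Gf (Lc ^ m) (sh (Lc ^ m) ((sh (Lc ^ m)).symm b)) (w + compShift μ ν j) -
            Gf (Lc ^ m) ((sh (Lc ^ m)).symm b) (w + compShift μ ν j)) := by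
        simp only [crossAt, Equiv.apply_symm_apply]; ring
      rw [e, abs_neg]
      exact h1x _ hn _ hb' _
    have hq := abs_stQx_le_local hμν (sh (Lc ^ m)) (fun b v => Gf (Lc ^ m) b v - gFree v) b w
      (e := fun j => D j / ((Lc ^ m : ℕ) : ℝ) ^ (j + 2)) (ex := D 3 / ((Lc ^ m : ℕ) : ℝ) ^ 3)
      (h0 _ hn b hb _) (h0 _ hn b hb _) (by simpa [add_assoc] using h1 _ hn b hb (w + unitVec μ) ν) (h1 _ hn b hb w ν)
      (by simpa [crossMix] using h2x _ hn b hb w) hcx i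
    rcases i with i | j
    · have ha : (bfQ hμν i).a - 2 + 2 = (bfQ hμν i).a := Nat.sub_add_cancel (two_le_bfQ_a hμν i)
      simp only [Sum.elim_inl, ha] at hq
      simpa [Sx, afQ] using hq
    · simpa [Sx, afQ] using hq
  exact WindowInterface.windowBound_of_scaleBound (Sx_nonneg hμν hD i) (two_le_afQ_a hμν i) hw0 hwn key

/-- **RE-LABELLED FIRST-LEG TAILS FROM GRADED DECAY, one base point, one shell point** (the bounds are used AT `w`, `‖w‖∞ = r+1`):
`d0/d1` and the CROSS second difference `d2×`. [folklore] -/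
theorem abs_stPx_le_of_decay (hμν : μ ≠ ν) {sh : Equiv.Perm κB} {G : κB → Pt → ℝ} {b : κB} {A : ℕ → ℝ} {c : ℝ}
    (d0 : ∀ v : Pt, v ≠ 0 → |G b v| ≤ A 0 * Real.exp (-c * supNorm v) / (supNorm v : ℝ) ^ 2)
    (d1 : ∀ v : Pt, v ≠ 0 → ∀ ρ : Fin 4, |G b (v + unitVec ρ) - G b v| ≤ A 1 * Real.exp (-c * supNorm v) / (supNorm v : ℝ) ^ 3)
    (d2x : ∀ v : Pt, v ≠ 0 → |crossMix μ ν sh G b v| ≤ A 2 * Real.exp (-c * supNorm v) / (supNorm v : ℝ) ^ 4)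
    {r : ℕ} {w : Pt} (hw : w ∈ annulus 4 r (r + 1)) (i : AfIdx) :
    |stPx μ ν sh G b i w| ≤ Rx' hμν A i / ((r : ℝ) + 1) ^ (afP hμν i).a * Real.exp (-c * ((r : ℝ) + 1)) := by
  have hw0 : w ≠ 0 := DyadicShell.ne_zero_of_mem_annulus hw
  have hsup : (supNorm w : ℝ) = (r : ℝ) + 1 := by rw [DyadicShell.supNorm_eq_of_mem_sphere hw]; push_cast; ring
  have key := abs_stPx_le_local hμν sh G b w (e := fun j => A j * Real.exp (-c * ((r : ℝ) + 1)) / ((r : ℝ) + 1) ^ (j + 2))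
    (by simpa [hsup] using d0 w hw0) (fun ρ => by simpa [hsup] using d1 w hw0 ρ) (by simpa [hsup] using d2x w hw0) i
  rcases i with i | j
  · have ha : (bfP hμν i).a - 2 + 2 = (bfP hμν i).a := Nat.sub_add_cancel (two_le_bfP_a hμν i)
    simp only [Sum.elim_inl, ha] at key
    calc |stPx μ ν sh G b (Sum.inl i) w| ≤ A ((bfP hμν i).a - 2) * Real.exp (-c * ((r : ℝ) + 1)) / ((r : ℝ) + 1) ^ (bfP hμν i).a := key
      _ = Rx' hμν A (Sum.inl i) / ((r : ℝ) + 1) ^ (afP hμν (Sum.inl i)).a * Real.exp (-c * ((r : ℝ) + 1)) := by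
          simp only [Rx', afP, Sum.elim_inl]; ring
  · simp only [Sum.elim_inr] at key
    calc |stPx μ ν sh G b (Sum.inr j) w| ≤ A 1 * Real.exp (-c * ((r : ℝ) + 1)) / ((r : ℝ) + 1) ^ (1 + 2) := key
      _ = Rx' hμν A (Sum.inr j) / ((r : ℝ) + 1) ^ (afP hμν (Sum.inr j)).a * Real.exp (-c * ((r : ℝ) + 1)) := by
          simp only [Rx', afP, Sum.elim_inr, TwoPower.fwdLeg_a]; ring

/-- **RE-LABELLED SECOND-LEG TAILS FROM GRADED DECAY, one base point, one shell point** (bounds used at `w + s`, `‖s‖∞ ≤ 1`, `‖w+s‖∞ ≥ r ≥ 1`;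
exponential dropped): `d0/d1`, the cross second difference `d2×` and the cross-base-point first difference `d1×` (at `sh⁻¹ b`). [folklore] -/
theorem abs_stQx_le_of_decay (hμν : μ ≠ ν) {sh : Equiv.Perm κB} {G : κB → Pt → ℝ} {b : κB} {A : ℕ → ℝ} {c : ℝ}
    (hA : ∀ j, 0 ≤ A j) (hc : 0 ≤ c)
    (d0 : ∀ v : Pt, v ≠ 0 → |G b v| ≤ A 0 * Real.exp (-c * supNorm v) / (supNorm v : ℝ) ^ 2)
    (d1 : ∀ v : Pt, v ≠ 0 → ∀ ρ : Fin 4, |G b (v + unitVec ρ) - G b v| ≤ A 1 * Real.exp (-c * supNorm v) / (supNorm v : ℝ) ^ 3)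
    (d2x : ∀ v : Pt, v ≠ 0 → |crossMix μ ν sh G b v| ≤ A 2 * Real.exp (-c * supNorm v) / (supNorm v : ℝ) ^ 4)
    (d1x : ∀ v : Pt, v ≠ 0 → |G (sh.symm b) v - G b v| ≤ A 3 * Real.exp (-c * supNorm v) / (supNorm v : ℝ) ^ 3)
    {r : ℕ} (hr : 1 ≤ r) {w : Pt} (hw : w ∈ annulus 4 r (r + 1)) (i : AfIdx) :
    |stQx μ ν sh G b i w| ≤ Sx' hμν A i / ((r : ℝ) + 1) ^ (afQ hμν i).a := by
  have hr0 : (0 : ℝ) < (r : ℝ) := by exact_mod_cast hr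
  have hr1 : (1 : ℝ) ≤ (r : ℝ) := by exact_mod_cast hr
  -- every evaluation point `v = w + s` with `‖s‖∞ ≤ 1` has `‖v‖∞ ≥ r`, hence `v ≠ 0`
  have hge : ∀ s : Pt, (supNorm s : ℝ) ≤ 1 → (r : ℝ) ≤ supNorm (w + s) ∧ w + s ≠ 0 := by
    intro s hs
    have hsup : (supNorm w : ℝ) = (r : ℝ) + 1 := by rw [DyadicShell.supNorm_eq_of_mem_sphere hw]; push_cast; ring
    have h := supNorm_sub_le_supNorm_add w s
    have hge : (r : ℝ) ≤ supNorm (w + s) := by linarith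
    refine ⟨hge, fun h0 => ?_⟩
    rw [h0] at hge
    simp at hge
    linarith
  have bnd : ∀ (a : ℕ) {X : ℝ}, 0 ≤ X → ∀ s : Pt, (supNorm s : ℝ) ≤ 1 →
      X * Real.exp (-c * supNorm (w + s)) / (supNorm (w + s) : ℝ) ^ a ≤ X / (r : ℝ) ^ a :=
    fun a X hX s hs => decay_le_pow a hX hc hr0 (hge s hs).1
  have hs0 : (supNorm (0 : Pt) : ℝ) ≤ 1 := by simp [supNorm_eq_zero_iff.mpr rfl]
  have hsμ : (supNorm (unitVec μ : Pt) : ℝ) ≤ 1 := by rw [supNorm_unitVec]; simp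
  have hsν : (supNorm (unitVec ν : Pt) : ℝ) ≤ 1 := by rw [supNorm_unitVec]; simp
  have hsμν : (supNorm (unitVec μ + unitVec ν : Pt) : ℝ) ≤ 1 := by rw [supNorm_unitVec_add hμν]; simp
  have hsj : ∀ j : Fin 3, (supNorm (compShift μ ν j) : ℝ) ≤ 1 := by
    intro j; fin_cases j
    · simpa [compShift] using hsμν
    · simpa [compShift] using hsν
    · simp [compShift]
  have e0a : |G b (w + (unitVec μ + unitVec ν))| ≤ A 0 / (r : ℝ) ^ (0 + 2) := (d0 _ (hge _ hsμν).2).trans (bnd _ (hA 0) _ hsμν)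
  have e0b : |G b (w + unitVec ν)| ≤ A 0 / (r : ℝ) ^ (0 + 2) := (d0 _ (hge _ hsν).2).trans (bnd _ (hA 0) _ hsν)
  have e1a : |G b (w + (unitVec μ + unitVec ν)) - G b (w + unitVec μ)| ≤ A 1 / (r : ℝ) ^ (1 + 2) := by
    have h := (d1 _ (hge _ hsμ).2 ν).trans (bnd _ (hA 1) _ hsμ)
    simpa [add_assoc] using h
  have e1b : |G b (w + unitVec ν) - G b w| ≤ A 1 / (r : ℝ) ^ (1 + 2) := by
    have h := (d1 _ (hge _ hs0).2 ν).trans (bnd _ (hA 1) _ hs0)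
    simpa using h
  have e2 : |crossMix μ ν sh G b w| ≤ A 2 / (r : ℝ) ^ (2 + 2) := by
    have h := (d2x _ (hge _ hs0).2).trans (bnd _ (hA 2) _ hs0)
    simpa using h
  have ex : ∀ j : Fin 3, |crossAt sh G b (compShift μ ν j) w| ≤ A 3 / (r : ℝ) ^ 3 := fun j =>
    (d1x _ (hge _ (hsj j)).2).trans (bnd 3 (hA 3) _ (hsj j))
  have key := abs_stQx_le_local hμν sh G b w (e := fun j => A j / (r : ℝ) ^ (j + 2)) (ex := A 3 / (r : ℝ) ^ 3)
    e0a e0b e1a e1b e2 ex i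
  rcases i with i | j
  · have ha : (bfQ hμν i).a - 2 + 2 = (bfQ hμν i).a := Nat.sub_add_cancel (two_le_bfQ_a hμν i)
    simp only [Sum.elim_inl, ha] at key
    simpa [Sx', afQ] using key.trans (pow_shift_le _ (hA _) hr1)
  · simp only [Sum.elim_inr] at key
    simpa [Sx', afQ] using key.trans (pow_shift_le 3 (hA 3) hr1)

/-- **`hFtail` OF THE AVERAGE-FIRST WALL FROM GRADED DECAY** (per base point; `R′ = Rx′`, rate `δ/n`, `n = Lc^m`). [folklore] -/
theorem hFxtail_of_decay (hμν : μ ≠ ν) {Lc : ℕ} {Bset : ℕ → Finset κB} {sh : ℕ → Equiv.Perm κB} {Gf : ℕ → κB → Pt → ℝ}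
    {A : ℕ → ℝ} {δ : ℝ} {M : ℕ → ℕ}
    (d0 : ∀ n : ℕ, 2 ≤ n → ∀ b ∈ Bset n, ∀ v : Pt, v ≠ 0 → |Gf n b v| ≤ A 0 * Real.exp (-(δ / n) * supNorm v) / (supNorm v : ℝ) ^ 2)
    (d1 : ∀ n : ℕ, 2 ≤ n → ∀ b ∈ Bset n, ∀ v : Pt, v ≠ 0 → ∀ ρ : Fin 4,
      |Gf n b (v + unitVec ρ) - Gf n b v| ≤ A 1 * Real.exp (-(δ / n) * supNorm v) / (supNorm v : ℝ) ^ 3)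
    (d2x : ∀ n : ℕ, 2 ≤ n → ∀ b ∈ Bset n, ∀ v : Pt, v ≠ 0 →
      |Gf n b (v + unitVec μ + unitVec ν) - Gf n b (v + unitVec μ) - (Gf n (sh n b) (v + unitVec ν) - Gf n (sh n b) v)| ≤
        A 2 * Real.exp (-(δ / n) * supNorm v) / (supNorm v : ℝ) ^ 4)
    (hL : 2 ≤ Lc) :
    ∀ m : ℕ, 1 ≤ m → ∀ b ∈ Bset (Lc ^ m), ∀ r : ℕ, M (Lc ^ m) ≤ r → ∀ w ∈ annulus 4 r (r + 1), ∀ i ∈ (Finset.univ : Finset AfIdx),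
      |stPx μ ν (sh (Lc ^ m)) (Gf (Lc ^ m)) b i w| ≤ Rx' hμν A i / ((r : ℝ) + 1) ^ (afP hμν i).a *
        Real.exp (-(δ / ((Lc ^ m : ℕ) : ℝ)) * ((r : ℝ) + 1)) := by
  intro m hm b hb r _ w hw i _
  have hn : 2 ≤ Lc ^ m := hL.trans (Nat.le_self_pow (by omega) Lc)
  exact abs_stPx_le_of_decay hμν (d0 _ hn b hb) (d1 _ hn b hb) (fun v hv => by simpa [crossMix] using d2x _ hn b hb v hv) hw i

/-- **`hGtail` OF THE AVERAGE-FIRST WALL FROM GRADED DECAY** (per base point; `S′ = Sx′`; needs the window floor `M ≥ 1` and `sh n` preserving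
`Bset n`, the cross first difference being used at `sh⁻¹ b`). [folklore] -/
theorem hGxtail_of_decay (hμν : μ ≠ ν) {Lc : ℕ} {Bset : ℕ → Finset κB} {sh : ℕ → Equiv.Perm κB} {Gf : ℕ → κB → Pt → ℝ}
    {A : ℕ → ℝ} {δ : ℝ} {M : ℕ → ℕ} (hA : ∀ j, 0 ≤ A j) (hδ : 0 < δ) (hM1 : ∀ L : ℕ, 2 ≤ L → 1 ≤ M L)
    (hshB : ∀ n : ℕ, 2 ≤ n → ∀ b, sh n b ∈ Bset n ↔ b ∈ Bset n)
    (d0 : ∀ n : ℕ, 2 ≤ n → ∀ b ∈ Bset n, ∀ v : Pt, v ≠ 0 → |Gf n b v| ≤ A 0 * Real.exp (-(δ / n) * supNorm v) / (supNorm v : ℝ) ^ 2)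
    (d1 : ∀ n : ℕ, 2 ≤ n → ∀ b ∈ Bset n, ∀ v : Pt, v ≠ 0 → ∀ ρ : Fin 4,
      |Gf n b (v + unitVec ρ) - Gf n b v| ≤ A 1 * Real.exp (-(δ / n) * supNorm v) / (supNorm v : ℝ) ^ 3)
    (d1x : ∀ n : ℕ, 2 ≤ n → ∀ b ∈ Bset n, ∀ v : Pt, v ≠ 0 →
      |Gf n (sh n b) v - Gf n b v| ≤ A 3 * Real.exp (-(δ / n) * supNorm v) / (supNorm v : ℝ) ^ 3)
    (d2x : ∀ n : ℕ, 2 ≤ n → ∀ b ∈ Bset n, ∀ v : Pt, v ≠ 0 →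
      |Gf n b (v + unitVec μ + unitVec ν) - Gf n b (v + unitVec μ) - (Gf n (sh n b) (v + unitVec ν) - Gf n (sh n b) v)| ≤
        A 2 * Real.exp (-(δ / n) * supNorm v) / (supNorm v : ℝ) ^ 4)
    (hL : 2 ≤ Lc) :
    ∀ m : ℕ, 1 ≤ m → ∀ b ∈ Bset (Lc ^ m), ∀ r : ℕ, M (Lc ^ m) ≤ r → ∀ w ∈ annulus 4 r (r + 1), ∀ i ∈ (Finset.univ : Finset AfIdx),
      |stQx μ ν (sh (Lc ^ m)) (Gf (Lc ^ m)) b i w| ≤ Sx' hμν A i / ((r : ℝ) + 1) ^ (afQ hμν i).a := by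
  intro m hm b hb r hr w hw i _
  have hn : 2 ≤ Lc ^ m := hL.trans (Nat.le_self_pow (by omega) Lc)
  have hc : (0 : ℝ) ≤ δ / ((Lc ^ m : ℕ) : ℝ) := by positivity
  have hb' : (sh (Lc ^ m)).symm b ∈ Bset (Lc ^ m) := by
    rw [← hshB _ hn, Equiv.apply_symm_apply]; exact hb
  refine abs_stQx_le_of_decay hμν hA hc (d0 _ hn b hb) (d1 _ hn b hb) (fun v hv => by simpa [crossMix] using d2x _ hn b hb v hv)
    (fun v hv => ?_) ((hM1 _ hn).trans hr) hw i
  have h := d1x _ hn _ hb' v hv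
  rw [Equiv.apply_symm_apply] at h
  rwa [abs_sub_comm] at h

end RelabelBounds

/-! ## §4 Per-base-point convergence and the identification binder from (W3b′)ₛₜ-avg -/

section AvgFirstIdent

variable {μ ν : Fin 4} {κB : Type*}

open Filter Topology
open Literature.MathematicalPhysics.QuantumFieldTheory.Balaban1983to89.Beta.MarginalTelescoping (composedCoeff)
open Literature.MathematicalPhysics.QuantumFieldTheory.Balaban1983to89.Beta.WindowIdentification (psum fullSum
  abs_fullSum_sub_psum_le tendsto_fullSum fullSum_eq_of_tendsto exists_tendsto_psum_of_shellBound)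
open Literature.MathematicalPhysics.QuantumFieldTheory.Balaban1983to89.Beta.WindowInterface (shellBound_of_legDecay)

/-- halving the rate buys one power: `X·e^{−cy}/y³ ≤ X·(2/c)·e^{−(c/2)y}/y⁴` for `c, y > 0`, `X ≥ 0` (`(c/2)y ≤ e^{(c/2)y}`). [folklore] -/
theorem decay_cube_le_halfRate {X c y : ℝ} (hX : 0 ≤ X) (hc : 0 < c) (hy : 0 < y) :
    X * Real.exp (-c * y) / y ^ 3 ≤ X * (2 / c) * Real.exp (-(c / 2) * y) / y ^ 4 := by
  have h1 : (c / 2) * y ≤ Real.exp ((c / 2) * y) := by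
    have := Real.add_one_le_exp ((c / 2) * y); linarith
  have hy2 : y ≤ (2 / c) * Real.exp ((c / 2) * y) := by
    calc y = (2 / c) * ((c / 2) * y) := by field_simp
      _ ≤ (2 / c) * Real.exp ((c / 2) * y) := mul_le_mul_of_nonneg_left h1 (by positivity)
  have e1 : Real.exp (-c * y) = Real.exp (-((c / 2) * y)) * Real.exp (-(c / 2) * y) := by
    rw [← Real.exp_add]; congr 1; ring
  have e2 : Real.exp ((c / 2) * y) * Real.exp (-((c / 2) * y)) = 1 := by
    rw [← Real.exp_add, add_neg_cancel, Real.exp_zero]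
  have key : y * Real.exp (-c * y) ≤ (2 / c) * Real.exp (-(c / 2) * y) := by
    calc y * Real.exp (-c * y) = y * Real.exp (-((c / 2) * y)) * Real.exp (-(c / 2) * y) := by rw [e1]; ring
      _ ≤ ((2 / c) * Real.exp ((c / 2) * y)) * Real.exp (-((c / 2) * y)) * Real.exp (-(c / 2) * y) := by
          gcongr
      _ = (2 / c) * Real.exp (-(c / 2) * y) := by rw [mul_assoc (2 / c), e2, mul_one]
  rw [div_le_div_iff₀ (by positivity) (by positivity)]
  calc X * Real.exp (-c * y) * y ^ 4 = X * y ^ 3 * (y * Real.exp (-c * y)) := by ring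
    _ ≤ X * y ^ 3 * ((2 / c) * Real.exp (-(c / 2) * y)) := mul_le_mul_of_nonneg_left key (by positivity)
    _ = X * (2 / c) * Real.exp (-(c / 2) * y) * y ^ 3 := by ring

/-- **PER-BASE-POINT CONVERGENCE OF THE STENCIL FULL SUMS UNDER THE AVERAGE-FIRST DECAY HYPOTHESES.**  The mixed second difference of a SINGLE
`G_b` is `X_b + Y_{sh b} − Y_b`, so `d2×` at `b` and `d1` at `b` and at `sh b ∈ B` give it degree-`3` exponential decay — one power short of the
table's degree, irrelevant for CONVERGENCE: halving the rate restores the degree with an `n`-dependent constant (`decay_cube_le_halfRate`), and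
§13's shellwise bound gives a limit of the partial sums (`WindowIdentification.exists_tendsto_psum_of_shellBound`). [folklore] -/
theorem exists_tendsto_psum_stK (hμν : μ ≠ ν) (N : ℝ) {n : ℕ} (hn : 2 ≤ n) {B : Finset κB} {sh : Equiv.Perm κB}
    (hB : ∀ b, sh b ∈ B ↔ b ∈ B) {G : κB → Pt → ℝ} {A : ℕ → ℝ} (hA : ∀ j, 0 ≤ A j) {δ : ℝ} (hδ : 0 < δ)
    (d0 : ∀ b ∈ B, ∀ v : Pt, v ≠ 0 → |G b v| ≤ A 0 * Real.exp (-(δ / n) * supNorm v) / (supNorm v : ℝ) ^ 2)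
    (d1 : ∀ b ∈ B, ∀ v : Pt, v ≠ 0 → ∀ ρ : Fin 4,
      |G b (v + unitVec ρ) - G b v| ≤ A 1 * Real.exp (-(δ / n) * supNorm v) / (supNorm v : ℝ) ^ 3)
    (d2x : ∀ b ∈ B, ∀ v : Pt, v ≠ 0 → |crossMix μ ν sh G b v| ≤ A 2 * Real.exp (-(δ / n) * supNorm v) / (supNorm v : ℝ) ^ 4)
    {b : κB} (hb : b ∈ B) : ∃ Lim : ℝ, Tendsto (psum (stK μ ν N (G b))) atTop (𝓝 Lim) := by
  have hn0 : (0 : ℝ) < n := by exact_mod_cast (by omega : 0 < n)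
  set c : ℝ := δ / n with hc
  have hc0 : 0 < c := div_pos hδ hn0
  have hsb : sh b ∈ B := (hB b).mpr hb
  -- the half rate
  set c' : ℝ := (δ / 2) / n with hc'
  have hcc' : c' = c / 2 := by rw [hc', hc]; ring
  have hc'0 : 0 ≤ c' := by positivity
  have hexp : ∀ v : Pt, Real.exp (-c * supNorm v) ≤ Real.exp (-c' * supNorm v) := fun v =>
    Real.exp_le_exp.mpr (by have h0 : (0 : ℝ) ≤ supNorm v := (by positivity); rw [hcc']; nlinarith)
  -- (1) the per-`b` mixed difference has degree-3 decay
  have hmix : ∀ v : Pt, v ≠ 0 →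
      |G b (v + unitVec ν + unitVec μ) - G b (v + unitVec ν) - G b (v + unitVec μ) + G b v| ≤
        (A 2 + 2 * A 1) * Real.exp (-c * supNorm v) / (supNorm v : ℝ) ^ 3 := by
    intro v hv
    have hs1 : (1 : ℝ) ≤ supNorm v := by exact_mod_cast DyadicShell.supNorm_pos hv
    have e : G b (v + unitVec ν + unitVec μ) - G b (v + unitVec ν) - G b (v + unitVec μ) + G b v =
        crossMix μ ν sh G b v + (G (sh b) (v + unitVec ν) - G (sh b) v) - (G b (v + unitVec ν) - G b v) := by
      simp only [crossMix, add_right_comm v (unitVec ν) (unitVec μ)]; ring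
    rw [e]
    have hX : A 2 * Real.exp (-c * supNorm v) / (supNorm v : ℝ) ^ 4 ≤ A 2 * Real.exp (-c * supNorm v) / (supNorm v : ℝ) ^ 3 := by
      apply div_le_div_of_nonneg_left (mul_nonneg (hA 2) (Real.exp_nonneg _)) (by positivity)
      exact pow_le_pow_right₀ hs1 (by norm_num)
    calc |crossMix μ ν sh G b v + (G (sh b) (v + unitVec ν) - G (sh b) v) - (G b (v + unitVec ν) - G b v)|
        ≤ |crossMix μ ν sh G b v + (G (sh b) (v + unitVec ν) - G (sh b) v)| + |G b (v + unitVec ν) - G b v| := abs_sub _ _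
      _ ≤ (|crossMix μ ν sh G b v| + |G (sh b) (v + unitVec ν) - G (sh b) v|) + |G b (v + unitVec ν) - G b v| := by
          gcongr; exact abs_add_le _ _
      _ ≤ (A 2 * Real.exp (-c * supNorm v) / (supNorm v : ℝ) ^ 3 + A 1 * Real.exp (-c * supNorm v) / (supNorm v : ℝ) ^ 3) +
            A 1 * Real.exp (-c * supNorm v) / (supNorm v : ℝ) ^ 3 :=
          add_le_add (add_le_add ((d2x b hb v hv).trans hX) (d1 _ hsb v hv ν)) (d1 b hb v hv ν)
      _ = (A 2 + 2 * A 1) * Real.exp (-c * supNorm v) / (supNorm v : ℝ) ^ 3 := by ring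
  -- (2) degree 4 at the half rate, and the weakened `d0/d1`
  have hA' : 0 ≤ (A 2 + 2 * A 1) * (2 / c) := by have := hA 1; have := hA 2; positivity
  have d2' : ∀ v : Pt, v ≠ 0 →
      |G b (v + unitVec ν + unitVec μ) - G b (v + unitVec ν) - G b (v + unitVec μ) + G b v| ≤
        (A 2 + 2 * A 1) * (2 / c) * Real.exp (-c' * supNorm v) / (supNorm v : ℝ) ^ 4 := by
    intro v hv
    have hy : (0 : ℝ) < supNorm v := by exact_mod_cast DyadicShell.supNorm_pos hv
    have h := (hmix v hv).trans (decay_cube_le_halfRate (by have := hA 1; have := hA 2; positivity) hc0 hy)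
    rwa [← hcc'] at h
  have d0' : ∀ v : Pt, v ≠ 0 → |G b v| ≤ A 0 * Real.exp (-c' * supNorm v) / (supNorm v : ℝ) ^ 2 := fun v hv =>
    (d0 b hb v hv).trans (div_le_div_of_nonneg_right (mul_le_mul_of_nonneg_left (hexp v) (hA 0)) (by positivity))
  have d1' : ∀ v : Pt, v ≠ 0 → ∀ ρ : Fin 4, |G b (v + unitVec ρ) - G b v| ≤ A 1 * Real.exp (-c' * supNorm v) / (supNorm v : ℝ) ^ 3 :=
    fun v hv ρ => (d1 b hb v hv ρ).trans (div_le_div_of_nonneg_right (mul_le_mul_of_nonneg_left (hexp v) (hA 1)) (by positivity))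
  -- (3) the §13 leg tails with the profile `A♭ = (A₀, A₁, (A₂+2A₁)·2/c)` at rate `c'`, and the shellwise bound of `stK`
  let Af : ℕ → ℝ := fun j => if j = 2 then (A 2 + 2 * A 1) * (2 / c) else A j
  have hAf : ∀ j, 0 ≤ Af j := by intro j; by_cases hj : j = 2 <;> simp [Af, hj, hA', hA]
  have hAf0 : Af 0 = A 0 := by simp [Af]
  have hAf1 : Af 1 = A 1 := by simp [Af]
  have hAf2 : Af 2 = (A 2 + 2 * A 1) * (2 / c) := by simp [Af]
  have htail : ∀ r : ℕ, 1 ≤ r → ∀ w ∈ annulus 4 r (r + 1),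
      |stK μ ν N (G b) w| ≤ (∑ i ∈ (Finset.univ : Finset BfIdx), |bfCoeff N i| *
          (Af ((bfP hμν i).a - 2) * (Af ((bfQ hμν i).a - 2) * 2 ^ (bfQ hμν i).a))) / ((r : ℝ) + 1) ^ 4 *
        Real.exp (-((δ / 2) / (n : ℝ)) * ((r : ℝ) + 1)) := by
    intro r hr w hw
    refine abs_stK_le_of_legTails hμν (Real.exp_nonneg _) (fun i _ => hAf _) hw ?_ ?_
    · intro i _
      exact abs_stP_le_of_decay hμν (A := Af) (c := c') (by rw [hAf0]; exact d0') (by rw [hAf1]; exact d1') (by rw [hAf2]; exact d2') hw i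
    · intro i _
      exact abs_stQ_le_of_decay hμν (A := Af) (c := c') hAf hc'0 (by rw [hAf0]; exact d0') (by rw [hAf1]; exact d1')
        (by rw [hAf2]; exact d2') hr hw i
  have hE : 0 ≤ ∑ i ∈ (Finset.univ : Finset BfIdx), |bfCoeff N i| * (Af ((bfP hμν i).a - 2) * (Af ((bfQ hμν i).a - 2) * 2 ^ (bfQ hμν i).a)) :=
    Finset.sum_nonneg fun i _ => mul_nonneg (abs_nonneg _) (mul_nonneg (hAf _) (mul_nonneg (hAf _) (by positivity)))
  exact exists_tendsto_psum_of_shellBound (M := 1) hE (half_pos hδ) hn0 htail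

/-- **A CONVEX (indeed any finite linear) COMBINATION OF CONVERGENT FULL SUMS IS THE FULL SUM OF THE COMBINED KERNEL.** [folklore] -/
theorem sum_mul_fullSum_eq {B : Finset κB} {wt : κB → ℝ} {K : κB → Pt → ℝ}
    (h : ∀ b ∈ B, ∃ Lb : ℝ, Tendsto (psum (K b)) atTop (𝓝 Lb)) :
    ∑ b ∈ B, wt b * fullSum (K b) = fullSum (fun w => ∑ b ∈ B, wt b * K b w) := by
  have hps : psum (fun w => ∑ b ∈ B, wt b * K b w) = fun R => ∑ b ∈ B, wt b * psum (K b) R := by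
    funext R
    simp only [psum, Finset.mul_sum]
    exact Finset.sum_comm
  have hT : Tendsto (psum (fun w => ∑ b ∈ B, wt b * K b w)) atTop (𝓝 (∑ b ∈ B, wt b * fullSum (K b))) := by
    rw [hps]
    exact tendsto_finsetSum B fun b hb => (tendsto_fullSum (h b hb)).const_mul (wt b)
  exact (fullSum_eq_of_tendsto hT).symm

/-- **THE `hident` BINDER OF THE AVERAGE-FIRST WALL FROM (W3b′)ₛₜ-avg** (the SAME full-sum comparison as §15): per-base-point convergence of the
stencil full sums, `sh n` preserving `Bset n` and `wt n`, and `b`-free tails of the RE-LABELLED legs give — via `Σ_b wt_b·fullSum(stK G_b) =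
fullSum(Σ_b wt_b·stK G_b)` (`sum_mul_fullSum_eq`) `= fullSum(Σ_b wt_b·stKx_b)` (`avg_stK_eq_avg_stKx`, pointwise) and the uniform window
truncation of the latter — the identification binder of `ComposedRoad.oneLoopDrift_of_composedLegInterfacePow_identity_avg` for the re-labelled
families over `AfIdx`, with `U + ε`. [folklore] -/
theorem hident_avgFirst (hμν : μ ≠ ν) {N : ℝ} {Lc : ℕ} (hL : 2 ≤ Lc) {μC : ℕ → ℕ → ℝ}
    {Bset : ℕ → Finset κB} {wt : ℕ → κB → ℝ} {sh : ℕ → Equiv.Perm κB} {Gf : ℕ → κB → Pt → ℝ} {R' S' : AfIdx → ℝ} {δ U : ℝ}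
    {M : ℕ → ℕ}
    (hwt0 : ∀ n : ℕ, 2 ≤ n → ∀ b ∈ Bset n, 0 ≤ wt n b) (hwt1 : ∀ n : ℕ, 2 ≤ n → ∑ b ∈ Bset n, wt n b = 1)
    (hshB : ∀ n : ℕ, 2 ≤ n → ∀ b, sh n b ∈ Bset n ↔ b ∈ Bset n) (hwtsh : ∀ n : ℕ, 2 ≤ n → ∀ b ∈ Bset n, wt n (sh n b) = wt n b)
    (hR' : ∀ i ∈ (Finset.univ : Finset AfIdx), 0 ≤ R' i) (hS' : ∀ i ∈ (Finset.univ : Finset AfIdx), 0 ≤ S' i) (hδ : 0 < δ)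
    (hFtail : ∀ m : ℕ, 1 ≤ m → ∀ b ∈ Bset (Lc ^ m), ∀ r : ℕ, M (Lc ^ m) ≤ r → ∀ w ∈ annulus 4 r (r + 1),
      ∀ i ∈ (Finset.univ : Finset AfIdx), |stPx μ ν (sh (Lc ^ m)) (Gf (Lc ^ m)) b i w| ≤
        R' i / ((r : ℝ) + 1) ^ (afP hμν i).a * Real.exp (-(δ / ((Lc ^ m : ℕ) : ℝ)) * ((r : ℝ) + 1)))
    (hGtail : ∀ m : ℕ, 1 ≤ m → ∀ b ∈ Bset (Lc ^ m), ∀ r : ℕ, M (Lc ^ m) ≤ r → ∀ w ∈ annulus 4 r (r + 1),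
      ∀ i ∈ (Finset.univ : Finset AfIdx), |stQx μ ν (sh (Lc ^ m)) (Gf (Lc ^ m)) b i w| ≤ S' i / ((r : ℝ) + 1) ^ (afQ hμν i).a)
    (hconv : ∀ m : ℕ, 1 ≤ m → ∀ b ∈ Bset (Lc ^ m), ∃ Lb : ℝ, Tendsto (psum (stK μ ν N (Gf (Lc ^ m) b))) atTop (𝓝 Lb))
    (hU : ∀ m : ℕ, 1 ≤ m → |composedCoeff μC m - ∑ b ∈ Bset (Lc ^ m), wt (Lc ^ m) b * fullSum (stK μ ν N (Gf (Lc ^ m) b))| ≤ U)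
    {ε : ℝ} (hε : 0 < ε) :
    ∀ m : ℕ, 1 ≤ m → ∃ R₀ : ℕ, M (Lc ^ m) ≤ R₀ ∧
      |composedCoeff μC m - ∑ b ∈ Bset (Lc ^ m), wt (Lc ^ m) b * ∑ w ∈ annulus 4 0 R₀, toReal w μ * toReal w ν *
        ∑ i ∈ (Finset.univ : Finset AfIdx), afCoeff N i *
          (stPx μ ν (sh (Lc ^ m)) (Gf (Lc ^ m)) b i w * stQx μ ν (sh (Lc ^ m)) (Gf (Lc ^ m)) b i w)| ≤ U + ε := by
  classical
  have hpow : ∀ m : ℕ, 1 ≤ m → 2 ≤ Lc ^ m := fun m hm => hL.trans (Nat.le_self_pow (by omega) Lc)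
  -- the averaged re-labelled kernel
  let K : ℕ → Pt → ℝ := fun m w => ∑ b ∈ Bset (Lc ^ m), wt (Lc ^ m) b * stKx μ ν N (sh (Lc ^ m)) (Gf (Lc ^ m)) b w
  have hE : 0 ≤ ∑ i ∈ (Finset.univ : Finset AfIdx), |afCoeff N i| * (R' i * S' i) :=
    Finset.sum_nonneg fun i hi => mul_nonneg (abs_nonneg _) (mul_nonneg (hR' i hi) (hS' i hi))
  -- its shellwise tail: convex combination of the per-`b` leg-tail bounds (total degree 6)
  have htail : ∀ m : ℕ, 1 ≤ m → ∀ r : ℕ, M (Lc ^ m) ≤ r → ∀ w ∈ annulus 4 r (r + 1),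
      |K m w| ≤ (∑ i ∈ (Finset.univ : Finset AfIdx), |afCoeff N i| * (R' i * S' i)) / ((r : ℝ) + 1) ^ 4 *
        Real.exp (-(δ / ((Lc ^ m : ℕ) : ℝ)) * ((r : ℝ) + 1)) := by
    intro m hm r hr w hw
    exact ComposedRoad.abs_convexComb_le (hwt0 _ (hpow m hm)) (hwt1 _ (hpow m hm)) fun b hb =>
      shellBound_of_legDecay (hdeg_af hμν) μ ν hw (Real.exp_nonneg _) hR' (hFtail m hm b hb r hr w hw) (hGtail m hm b hb r hr w hw)
  -- (W3b′) for the averaged re-labelled kernel: the SAME number as the `wt`-combination of the per-`b` stencil full sums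
  have hU' : ∀ m : ℕ, 1 ≤ m → |composedCoeff μC m - fullSum (K m)| ≤ U := by
    intro m hm
    have h1 : ∑ b ∈ Bset (Lc ^ m), wt (Lc ^ m) b * fullSum (stK μ ν N (Gf (Lc ^ m) b)) =
        fullSum (fun w => ∑ b ∈ Bset (Lc ^ m), wt (Lc ^ m) b * stK μ ν N (Gf (Lc ^ m) b) w) :=
      sum_mul_fullSum_eq (hconv m hm)
    have h2 : (fun w => ∑ b ∈ Bset (Lc ^ m), wt (Lc ^ m) b * stK μ ν N (Gf (Lc ^ m) b) w) = K m :=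
      funext fun w => avg_stK_eq_avg_stKx N (sh (Lc ^ m)) (hshB _ (hpow m hm)) (hwtsh _ (hpow m hm)) (Gf (Lc ^ m)) w
    have h := hU m hm
    rwa [h1, h2] at h
  intro m hm
  obtain ⟨R₀, hR₀, h⟩ := hident_of_fullSum_graded (K := K) (by omega) hE hδ htail hU' hε m hm
  refine ⟨R₀, hR₀, ?_⟩
  have e : ∑ w ∈ annulus 4 0 R₀, K m w = ∑ b ∈ Bset (Lc ^ m), wt (Lc ^ m) b * ∑ w ∈ annulus 4 0 R₀, toReal w μ * toReal w ν *
      ∑ i ∈ (Finset.univ : Finset AfIdx), afCoeff N i *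
        (stPx μ ν (sh (Lc ^ m)) (Gf (Lc ^ m)) b i w * stQx μ ν (sh (Lc ^ m)) (Gf (Lc ^ m)) b i w) := by
    simp only [K, stKx, Finset.mul_sum]
    exact Finset.sum_comm
  rwa [e] at h

end AvgFirstIdent

/-! ## §5 The average-first scalar wall and its end statement -/

section AvgFirstWall

variable {μ ν : Fin 4} {κB : Type*}

open Filter Topology
open FlowStep DagBinding
open Literature.MathematicalPhysics.QuantumFieldTheory.Balaban1983to89.Beta.LargeLWindow.WindowDecomposition (constA)
open Literature.MathematicalPhysics.QuantumFieldTheory.Balaban1983to89.Beta.Drift (OneLoopDrift)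
open Literature.MathematicalPhysics.QuantumFieldTheory.Balaban1983to89.Beta.MarginalTelescoping (composedCoeff IdentityForm)
open Literature.MathematicalPhysics.QuantumFieldTheory.Balaban1983to89.Beta.LeadingCoefficient (kappaBal transverseValue)
open Literature.MathematicalPhysics.QuantumFieldTheory.Balaban1983to89.Beta.RemainderChain (RemainderConst)
open Literature.MathematicalPhysics.QuantumFieldTheory.Balaban1983to89.Beta.DriftRemainder
  (endpointExistence_of_drift_remainderConst)
open Literature.MathematicalPhysics.QuantumFieldTheory.Balaban1983to89.Beta.WindowIdentification (psum fullSum)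
open Literature.MathematicalPhysics.QuantumFieldTheory.Balaban1983to89.Beta.ComposedRoad
  (oneLoopDrift_of_composedLegInterfacePow_identity_avg)

/-- **THE AVERAGE-FIRST SCALAR WALL** (RULING (R14-6)): `ComposedRoad.oneLoopDrift_of_composedLegInterfacePow_identity_avg` for the ENLARGED
table (`AfIdx`, re-labelled actual legs `stPx/stQx`) with SCALAR inputs — window data; convex weights `wt n` on finite base-point sets `Bset n`
and permutations `sh n` of the base points preserving `Bset n` (`hshB`) and `wt n` (`hwtsh`); a kernel family `G_{n,b}` with EIGHT graded bounds
for every `b ∈ Bset n`, constants free of `b`: against `gFree` on the whole lattice `h0/h1` (`D₀/n²`, `D₁/n³`), the cross-base-point FIRST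
difference `h1×` (`|G_{n,sh b} − G_{n,b}| ≤ D₃/n³`) and the cross-base-point mixed SECOND difference `h2×` (`|X_b| ≤ D₂/n⁴`, `crossMix` of
`G_{n,·} − gFree`); off the origin with decay `d0/d1/d1×/d2×` (`A₀, A₁, A₃, A₂` against `e^{−(δ/n)‖v‖}‖v‖^{−2,−3,−3,−4}`) — the PER-BASE-POINT
mixed second differences `h2/d2` of §15 do not occur; ONE comparison per scale of `composedCoeff μC m` with the `wt`-combination of the full
lattice sums `fullSum (stK G_{Lc^m,b})` ((W3b′)ₛₜ-avg, the same statement as in §15); `IdentityForm`.  Conclusion: the drift with the transfer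
constant `bubbleConst` of the REALISED table and window/tail sums over the enlarged index set (`Rx, Sx, Rx′, Sx′`).  Nothing about Bałaban's
propagators is asserted. [folklore] -/
theorem oneLoopDrift_of_scalarBounds_avgFirst {β : HBeta} (S : B12Beta.OneLoopSplit β) (hμν : μ ≠ ν) {N : ℝ} (hN : N ≠ 0)
    {Lc : ℕ} (hL : 2 ≤ Lc) {μC : ℕ → ℕ → ℝ} {Bset : ℕ → Finset κB} {wt : ℕ → κB → ℝ} {sh : ℕ → Equiv.Perm κB}
    {Gf : ℕ → κB → Pt → ℝ} {D A : ℕ → ℝ} (hD : ∀ j, 0 ≤ D j) (hA : ∀ j, 0 ≤ A j) {δ U cc : ℝ} {M : ℕ → ℕ} (hδ : 0 < δ)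
    (hwt0 : ∀ n : ℕ, 2 ≤ n → ∀ b ∈ Bset n, 0 ≤ wt n b) (hwt1 : ∀ n : ℕ, 2 ≤ n → ∑ b ∈ Bset n, wt n b = 1)
    (hshB : ∀ n : ℕ, 2 ≤ n → ∀ b, sh n b ∈ Bset n ↔ b ∈ Bset n) (hwtsh : ∀ n : ℕ, 2 ≤ n → ∀ b ∈ Bset n, wt n (sh n b) = wt n b)
    (hc : 1 ≤ cc) (hM : ∀ L : ℕ, 2 ≤ L → 1 ≤ M L ∧ (L : ℝ) ≤ cc * M L) (hML : ∀ L : ℕ, 2 ≤ L → M L ≤ L)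
    (h0 : ∀ n : ℕ, 2 ≤ n → ∀ b ∈ Bset n, ∀ v, |Gf n b v - gFree v| ≤ D 0 / (n : ℝ) ^ 2)
    (h1 : ∀ n : ℕ, 2 ≤ n → ∀ b ∈ Bset n, ∀ v (ρ : Fin 4),
      |(Gf n b (v + unitVec ρ) - gFree (v + unitVec ρ)) - (Gf n b v - gFree v)| ≤ D 1 / (n : ℝ) ^ 3)
    (h1x : ∀ n : ℕ, 2 ≤ n → ∀ b ∈ Bset n, ∀ v, |Gf n (sh n b) v - Gf n b v| ≤ D 3 / (n : ℝ) ^ 3)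
    (h2x : ∀ n : ℕ, 2 ≤ n → ∀ b ∈ Bset n, ∀ v,
      |(Gf n b (v + unitVec μ + unitVec ν) - gFree (v + unitVec μ + unitVec ν)) - (Gf n b (v + unitVec μ) - gFree (v + unitVec μ)) -
          ((Gf n (sh n b) (v + unitVec ν) - gFree (v + unitVec ν)) - (Gf n (sh n b) v - gFree v))| ≤ D 2 / (n : ℝ) ^ 4)
    (d0 : ∀ n : ℕ, 2 ≤ n → ∀ b ∈ Bset n, ∀ v : Pt, v ≠ 0 → |Gf n b v| ≤ A 0 * Real.exp (-(δ / n) * supNorm v) / (supNorm v : ℝ) ^ 2)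
    (d1 : ∀ n : ℕ, 2 ≤ n → ∀ b ∈ Bset n, ∀ v : Pt, v ≠ 0 → ∀ ρ : Fin 4,
      |Gf n b (v + unitVec ρ) - Gf n b v| ≤ A 1 * Real.exp (-(δ / n) * supNorm v) / (supNorm v : ℝ) ^ 3)
    (d1x : ∀ n : ℕ, 2 ≤ n → ∀ b ∈ Bset n, ∀ v : Pt, v ≠ 0 →
      |Gf n (sh n b) v - Gf n b v| ≤ A 3 * Real.exp (-(δ / n) * supNorm v) / (supNorm v : ℝ) ^ 3)
    (d2x : ∀ n : ℕ, 2 ≤ n → ∀ b ∈ Bset n, ∀ v : Pt, v ≠ 0 →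
      |Gf n b (v + unitVec μ + unitVec ν) - Gf n b (v + unitVec μ) - (Gf n (sh n b) (v + unitVec ν) - Gf n (sh n b) v)| ≤
        A 2 * Real.exp (-(δ / n) * supNorm v) / (supNorm v : ℝ) ^ 4)
    (hU : ∀ m : ℕ, 1 ≤ m → |composedCoeff μC m - ∑ b ∈ Bset (Lc ^ m), wt (Lc ^ m) b * fullSum (stK μ ν N (Gf (Lc ^ m) b))| ≤ U)
    (hid : IdentityForm μC S.β0) :
    OneLoopDrift (B12Normalization.stepBal N Lc)
      (constA (|kappaBal N| * 24 + |kappaBal N| * 110592) (bubbleConst Finset.univ (bfCoeff N) (bfP hμν) (bfQ hμν))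
          ((80 * (∑ i ∈ (Finset.univ : Finset AfIdx), |afCoeff N i| * (Rx' hμν A i * Sx' hμν A i)) * (1 + cc / δ) + (U + 1)) +
            80 * ∑ i ∈ (Finset.univ : Finset AfIdx), |afCoeff N i| *
              ((((afP hμν i).A + (afP hμν i).B) * Sx hμν D i + Rx hμν D i * ((afQ hμν i).A + (afQ hμν i).B) + Rx hμν D i * Sx hμν D i)))
          cc (kappaBal N * transverseValue)) S.β0 := by
  have hpow : ∀ m : ℕ, 1 ≤ m → 2 ≤ Lc ^ m := fun m hm => hL.trans (Nat.le_self_pow (by omega) Lc)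
  have hR' : ∀ i ∈ (Finset.univ : Finset AfIdx), 0 ≤ Rx' hμν A i := fun i _ => Rx'_nonneg hμν hA i
  have hS' : ∀ i ∈ (Finset.univ : Finset AfIdx), 0 ≤ Sx' hμν A i := fun i _ => Sx'_nonneg hμν hA i
  have hFt := hFxtail_of_decay hμν (M := M) d0 d1 d2x hL
  have hGt := hGxtail_of_decay hμν hA hδ (fun L hL2 => (hM L hL2).1) hshB d0 d1 d1x d2x hL
  have hconv : ∀ m : ℕ, 1 ≤ m → ∀ b ∈ Bset (Lc ^ m),
      ∃ Lb : ℝ, Tendsto (psum (stK μ ν N (Gf (Lc ^ m) b))) atTop (𝓝 Lb) := fun m hm b hb =>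
    exists_tendsto_psum_stK hμν N (hpow m hm) (hshB _ (hpow m hm)) hA hδ (d0 _ (hpow m hm)) (d1 _ (hpow m hm))
      (fun b hb v hv => by simpa [crossMix] using d2x _ (hpow m hm) b hb v hv) hb
  have h := oneLoopDrift_of_composedLegInterfacePow_identity_avg S (hdeg_af hμν) hμν hN (hval_af hμν N) hL
    (F' := fun b i n w => stPx μ ν (sh n) (Gf n) b i w) (G' := fun b i n w => stQx μ ν (sh n) (Gf n) b i w) hwt0 hwt1
    (fun i _ => Rx_nonneg hμν hD i) (fun i _ => Sx_nonneg hμν hD i) hR' hS' hδ hc hM hML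
    (hFx_of_graded hμν hL hML hD h0 h1 h2x) (hGx_of_graded hμν hL hML hD hshB h0 h1 h1x h2x) hFt hGt
    (hident_avgFirst hμν hL hwt0 hwt1 hshB hwtsh hR' hS' hδ hFt hGt hconv hU one_pos) hid
  rw [bubbleConst_af] at h
  exact h

/-- **`EndpointExistence` FROM THE AVERAGE-FIRST SCALAR INPUTS** (RULING (R14-6); `endpointExistence_of_scalarBounds_avg` with the per-base-point
mixed second differences replaced by the cross-base-point ones + the shift structure).  Value = kernel certificate of the bookkeeping; nothing of
Bałaban's propagators, and nothing beyond the END STATEMENT of the honest framing, is asserted. [folklore] -/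
theorem endpointExistence_of_scalarBounds_avgFirst {β : HBeta} {Cn : B12.Construction} (hgen : ForwardGenerated Cn β)
    (S : B12Beta.OneLoopSplit β) (hμν : μ ≠ ν) {N : ℝ} (hN : N ≠ 0)
    {Lc : ℕ} (hL : 2 ≤ Lc) {μC : ℕ → ℕ → ℝ} {Bset : ℕ → Finset κB} {wt : ℕ → κB → ℝ} {sh : ℕ → Equiv.Perm κB}
    {Gf : ℕ → κB → Pt → ℝ} {D A : ℕ → ℝ} (hD : ∀ j, 0 ≤ D j) (hA : ∀ j, 0 ≤ A j) {δ U cc : ℝ} {M : ℕ → ℕ} (hδ : 0 < δ)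
    (hwt0 : ∀ n : ℕ, 2 ≤ n → ∀ b ∈ Bset n, 0 ≤ wt n b) (hwt1 : ∀ n : ℕ, 2 ≤ n → ∑ b ∈ Bset n, wt n b = 1)
    (hshB : ∀ n : ℕ, 2 ≤ n → ∀ b, sh n b ∈ Bset n ↔ b ∈ Bset n) (hwtsh : ∀ n : ℕ, 2 ≤ n → ∀ b ∈ Bset n, wt n (sh n b) = wt n b)
    (hc : 1 ≤ cc) (hM : ∀ L : ℕ, 2 ≤ L → 1 ≤ M L ∧ (L : ℝ) ≤ cc * M L) (hML : ∀ L : ℕ, 2 ≤ L → M L ≤ L)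
    (h0 : ∀ n : ℕ, 2 ≤ n → ∀ b ∈ Bset n, ∀ v, |Gf n b v - gFree v| ≤ D 0 / (n : ℝ) ^ 2)
    (h1 : ∀ n : ℕ, 2 ≤ n → ∀ b ∈ Bset n, ∀ v (ρ : Fin 4),
      |(Gf n b (v + unitVec ρ) - gFree (v + unitVec ρ)) - (Gf n b v - gFree v)| ≤ D 1 / (n : ℝ) ^ 3)
    (h1x : ∀ n : ℕ, 2 ≤ n → ∀ b ∈ Bset n, ∀ v, |Gf n (sh n b) v - Gf n b v| ≤ D 3 / (n : ℝ) ^ 3)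
    (h2x : ∀ n : ℕ, 2 ≤ n → ∀ b ∈ Bset n, ∀ v,
      |(Gf n b (v + unitVec μ + unitVec ν) - gFree (v + unitVec μ + unitVec ν)) - (Gf n b (v + unitVec μ) - gFree (v + unitVec μ)) -
          ((Gf n (sh n b) (v + unitVec ν) - gFree (v + unitVec ν)) - (Gf n (sh n b) v - gFree v))| ≤ D 2 / (n : ℝ) ^ 4)
    (d0 : ∀ n : ℕ, 2 ≤ n → ∀ b ∈ Bset n, ∀ v : Pt, v ≠ 0 → |Gf n b v| ≤ A 0 * Real.exp (-(δ / n) * supNorm v) / (supNorm v : ℝ) ^ 2)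
    (d1 : ∀ n : ℕ, 2 ≤ n → ∀ b ∈ Bset n, ∀ v : Pt, v ≠ 0 → ∀ ρ : Fin 4,
      |Gf n b (v + unitVec ρ) - Gf n b v| ≤ A 1 * Real.exp (-(δ / n) * supNorm v) / (supNorm v : ℝ) ^ 3)
    (d1x : ∀ n : ℕ, 2 ≤ n → ∀ b ∈ Bset n, ∀ v : Pt, v ≠ 0 →
      |Gf n (sh n b) v - Gf n b v| ≤ A 3 * Real.exp (-(δ / n) * supNorm v) / (supNorm v : ℝ) ^ 3)
    (d2x : ∀ n : ℕ, 2 ≤ n → ∀ b ∈ Bset n, ∀ v : Pt, v ≠ 0 →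
      |Gf n b (v + unitVec μ + unitVec ν) - Gf n b (v + unitVec μ) - (Gf n (sh n b) (v + unitVec ν) - Gf n (sh n b) v)| ≤
        A 2 * Real.exp (-(δ / n) * supNorm v) / (supNorm v : ℝ) ^ 4)
    (hU : ∀ m : ℕ, 1 ≤ m → |composedCoeff μC m - ∑ b ∈ Bset (Lc ^ m), wt (Lc ^ m) b * fullSum (stK μ ν N (Gf (Lc ^ m) b))| ≤ U)
    (hid : IdentityForm μC S.β0)
    {rr γ₀ β' : ℝ} (hγ₀ : 0 < γ₀) (hrem : RemainderConst S γ₀ rr) (hr : rr ≤ B12Normalization.stepBal N Lc)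
    (hβ' : 0 ≤ β') (hcont : BetaContH γ₀ β) (hup : BetaUpperH β' γ₀ β) : EndpointExistence Cn :=
  endpointExistence_of_drift_remainderConst hgen S hγ₀
    (oneLoopDrift_of_scalarBounds_avgFirst S hμν hN hL hD hA hδ hwt0 hwt1 hshB hwtsh hc hM hML h0 h1 h1x h2x d0 d1 d1x d2x hU hid)
    hrem hr hβ' hcont hup

end AvgFirstWall

/-! ## Examples -/

section AvgFirstExamples

/-- the enlarged (average-first) table has Bałaban's `hval` exactly, like the realised one (the companions are invisible in the continuum).
[folklore] -/
example {μ ν : Fin 4} (hμν : μ ≠ ν) (x : E4) (hx : x ≠ 0) :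
    x μ * x ν * contBubble Finset.univ (afCoeff 2) (afP hμν) (afQ hμν) x = leadingIntegrand (kappaBal 2) μ ν x := hval_af hμν 2 x hx

/-- degree bookkeeping of a companion product: `3 + 3`. [folklore] -/
example {μ ν : Fin 4} (hμν : μ ≠ ν) : (afP hμν (Sum.inr 0)).a + (afQ hμν (Sum.inr 0)).a = 6 := hdeg_af hμν _ (Finset.mem_univ _)

/-- for a base-point-INDEPENDENT family the companions' second legs vanish and `X_b` is the ordinary mixed second difference: the re-labelled
kernel is the stencil kernel. [folklore] -/
example {κB : Type*} {μ ν : Fin 4} (N : ℝ) (sh : Equiv.Perm κB) (G : Pt → ℝ) (b : κB) (w : Pt) :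
    stKx μ ν N sh (fun _ => G) b w = stK μ ν N G w := by
  rw [stK_eq_stKx_add (μ := μ) (ν := ν) N sh (fun _ => G) b w]
  simp [bdry]

end AvgFirstExamples

end Literature.MathematicalPhysics.QuantumFieldTheory.Balaban1983to89.Beta.SquareTableAvgFirst
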